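import Summits.Schanuel.Schanuel.Theorems.RootDecomp1KHyper70

/-!
# RootDecomp1KHyper — lens 6, generation 17 «BILOG STAIRCASE CELL» (BilogStair.lean edition 6 9dc464df…, 4886 l; §P `conjDataII_holds`, `transferII_holds`) — continuation (RootDecomp1KHyper71): §P (ii) the conjugate polynomial `conjPoly`, `conjData_pointwise`, `conjDataII_holds : ConjDataII`, `innerNormII_holds`, `transferII_holds : TransferII`, `sb_three_zB_of_transferI`

(lens-6 g17 `BilogStair.lean` EDITION 6, sha256 9dc464df…9ee3, 4886 l, own farm rc 0 · 0 warn · 0 sorry · axioms std; §A–§O = editions 2–5 (ported as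
`RootDecomp1KHyper53`–`69`), §P appended in edition 6 (NODE/EDITION6 L1806 / REQUEST L1807: statement diff 0 removed / 0 changed / 42 added — THEOREM-credit claim
for `transferII_holds : TransferII` under L1724 Q3 / L1789; writer re-check L1811; critic VERDICT L1812: ONE THEOREM credit to lens-6 g17 for `transferII_holds`, PORT GO); port by census-1 gen 16 in parts `RootDecomp1KHyper70`–`71` at the
lens's cut — 70 = §P power identity `gam_pow_eq`, envelope relation `envG` / `univ0` / `envPoly` (zeros ↔ x^N = α_j^M; kills γ_k and its ℚ-conjugates; ≠ 0; degree and
root bounds), α-data `exists_intPoly`, `exists_house_const`, denominators `isIntegral_lc_mul` / `isIntegral_tc_mul_inv` / `isIntegral_denom_mul`; 71 = the conjugate polynomial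
`conjPoly D γ = (minpoly ℤ (Dγ))(D·T)` (≠ 0, kills γ, roots = IsConjRoot ℚ γ, degree ≤ any integer killer, coefficient bounds), `conjData_pointwise`, `conjDataII_holds : ConjDataII`,
`innerNormII_holds`, `transferII_holds : TransferII` (TRANSFER II AS TYPED SINCE ED.1 IS A THEOREM, hypothesis-free), `sb_three_zB_of_transferI (hI : TransferI) : SB 3 zB`.
PORT edits: `pow_eq_exp_log` / `isIntegral_intCast'` / `coeff_comp_C_mul_X` private (per-part copies); sixteen one-line docstrings added; statements and proofs otherwise verbatim.
`--supports stmt-Schanuel-33363`; no census credit carried by the port (TransferI and the member package Q1/Q2 remain open for the THIRD⁗ cell credit); rung 0.)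
-/

open Complex Polynomial IntermediateField Filter
open scoped BigOperators

namespace Summit.Schanuel.Schanuel.Theorems.RootDecomp1KHyper

namespace HyperCell

namespace LatCell

namespace Bilog

variable {n : ℕ}
open Summit.Schanuel.Schanuel.Theorems.RootDecomp1KRelLiouvilleCell (mvPolyMeasure_one_of_polyMeasure ycoeff
  mvaeval_cons_eq_sum mvlen_ycoeff_le natDegree_finSuccEquiv_le_totalDegree norm_mvaeval_le_mvlen_mul_pow)

section ConjDataDev

/-- Roots of the complexified integer polynomial are its complex zeros. -/
private theorem mem_roots_map_iff {f : ℤ[X]} (hf : f ≠ 0) (z : ℂ) :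
    z ∈ (f.map (Int.castRingHom ℂ)).roots ↔ Polynomial.aeval z f = 0 := by
  rw [Polynomial.mem_roots ((Polynomial.map_ne_zero_iff (Int.castRingHom ℂ).injective_int).mpr hf),
    Polynomial.IsRoot.def, Polynomial.eval_map, Polynomial.aeval_def, algebraMap_int_eq]

/-- The CONJUGATE POLYNOMIAL of `γ` with denominator `D`: `(minpoly ℤ (Dγ))(D·T) ∈ ℤ[T]`. -/
noncomputable def conjPoly (D : ℤ) (γ : ℂ) : ℤ[X] :=
  (minpoly ℤ ((D : ℂ) * γ)).comp (Polynomial.C D * Polynomial.X)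

/-- Evaluating `conjPoly D γ` at `z` is evaluating `minpoly ℤ (Dγ)` at `Dz`. -/
theorem aeval_conjPoly (D : ℤ) (γ z : ℂ) :
    Polynomial.aeval z (conjPoly D γ) = Polynomial.aeval ((D : ℂ) * z) (minpoly ℤ ((D : ℂ) * γ)) := by
  unfold conjPoly
  rw [Polynomial.aeval_comp]
  congr 1
  simp

/-- `conjPoly D γ ≠ 0` for `D ≠ 0` and `Dγ` integral. -/
theorem conjPoly_ne_zero {D : ℤ} (hD : D ≠ 0) {γ : ℂ} (hint : IsIntegral ℤ ((D : ℂ) * γ)) :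
    conjPoly D γ ≠ 0 := by
  intro h
  have h1 := congrArg Polynomial.natDegree h
  rw [conjPoly, Polynomial.natDegree_comp, Polynomial.natDegree_C_mul_X _ hD, mul_one,
    Polynomial.natDegree_zero] at h1
  exact absurd h1 (minpoly.natDegree_pos hint).ne'

/-- `deg (conjPoly D γ) = deg (minpoly ℤ (Dγ))` for `D ≠ 0`. -/
theorem natDegree_conjPoly {D : ℤ} (hD : D ≠ 0) (γ : ℂ) :
    (conjPoly D γ).natDegree = (minpoly ℤ ((D : ℂ) * γ)).natDegree := by
  rw [conjPoly, Polynomial.natDegree_comp, Polynomial.natDegree_C_mul_X _ hD, mul_one]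

/-- `conjPoly D γ` vanishes at `γ`. -/
theorem aeval_conjPoly_self (D : ℤ) (γ : ℂ) : Polynomial.aeval γ (conjPoly D γ) = 0 := by
  rw [aeval_conjPoly]; exact minpoly.aeval ℤ _

/-- Scaling by a non-zero rational integer preserves `ℚ`-conjugacy. -/
theorem isConjRoot_of_mul {D : ℤ} (hD : D ≠ 0) {γ z : ℂ} (hγ : IsIntegral ℚ γ)
    (h : IsConjRoot ℚ ((D : ℂ) * γ) ((D : ℂ) * z)) : IsConjRoot ℚ γ z := by
  have hD' : (D : ℂ) ≠ 0 := by exact_mod_cast hD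
  set p := minpoly ℚ γ with hp
  set q : ℚ[X] := p.comp (Polynomial.C ((D : ℚ)⁻¹) * Polynomial.X) with hq
  have haev : ∀ w : ℂ, Polynomial.aeval ((D : ℂ) * w) q = Polynomial.aeval w p := by
    intro w
    rw [hq, Polynomial.aeval_comp]
    congr 1
    simp [hD']
  have h1 : Polynomial.aeval ((D : ℂ) * γ) q = 0 := by rw [haev, hp, minpoly.aeval]
  have h2 : minpoly ℚ ((D : ℂ) * z) ∣ q := by
    rw [show minpoly ℚ ((D : ℂ) * z) = minpoly ℚ ((D : ℂ) * γ) from h.symm]; exact minpoly.dvd ℚ _ h1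
  have h3 : Polynomial.aeval z p = 0 := by
    rw [← haev]; exact Polynomial.aeval_eq_zero_of_dvd_aeval_eq_zero h2 (minpoly.aeval ℚ _)
  exact (minpoly.eq_of_irreducible_of_monic (minpoly.irreducible hγ) h3 (minpoly.monic hγ))

/-- Every complex root of the conjugate polynomial is a `ℚ`-conjugate of `γ`. -/
theorem isConjRoot_of_aeval_conjPoly {D : ℤ} (hD : D ≠ 0) {γ : ℂ} (hint : IsIntegral ℤ ((D : ℂ) * γ))
    {z : ℂ} (hz : Polynomial.aeval z (conjPoly D γ) = 0) : IsConjRoot ℚ γ z := by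
  have hD' : (D : ℂ) ≠ 0 := by exact_mod_cast hD
  have hβQ : IsIntegral ℚ ((D : ℂ) * γ) := hint.tower_top
  have hγQ : IsIntegral ℚ γ := by
    have h := (isIntegral_algebraMap (R := ℚ) (A := ℂ) (x := ((D : ℚ))⁻¹)).mul hβQ
    have he : algebraMap ℚ ℂ ((D : ℚ)⁻¹) * ((D : ℂ) * γ) = γ := by
      simp [hD']
    rwa [he] at h
  refine isConjRoot_of_mul hD hγQ ?_
  -- `D z` is a root of `minpoly ℚ (Dγ) = map (minpoly ℤ (Dγ))`
  rw [aeval_conjPoly] at hz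
  have h1 : Polynomial.aeval ((D : ℂ) * z) (minpoly ℚ ((D : ℂ) * γ)) = 0 := by
    rw [minpoly.isIntegrallyClosed_eq_field_fractions' ℚ hint, Polynomial.aeval_map_algebraMap]
    exact hz
  exact (minpoly.eq_of_irreducible_of_monic (minpoly.irreducible hβQ) h1 (minpoly.monic hβQ))

/-- Degree of the conjugate polynomial `≤` degree of ANY non-zero integer polynomial killing `γ`. -/
theorem natDegree_conjPoly_le {D : ℤ} (hD : D ≠ 0) {γ : ℂ} (hint : IsIntegral ℤ ((D : ℂ) * γ))
    {g : ℤ[X]} (hg : g ≠ 0) (hgγ : Polynomial.aeval γ g = 0) :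
    (conjPoly D γ).natDegree ≤ g.natDegree := by
  have hβQ : IsIntegral ℚ ((D : ℂ) * γ) := hint.tower_top
  rw [natDegree_conjPoly hD,
    ← Polynomial.natDegree_map_eq_of_injective (algebraMap ℤ ℚ).injective_int (minpoly ℤ _),
    ← minpoly.isIntegrallyClosed_eq_field_fractions' ℚ hint]
  -- the scaled polynomial `g.scaleRoots D` kills `Dγ`
  have h1 : Polynomial.aeval ((D : ℂ) * γ) ((g.scaleRoots D).map (algebraMap ℤ ℚ)) = 0 := by
    rw [Polynomial.aeval_map_algebraMap]
    have h := Polynomial.scaleRoots_aeval_eq_zero (r := D) hgγ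
    rwa [algebraMap_int_eq, eq_intCast] at h
  have h2 : (g.scaleRoots D).map (algebraMap ℤ ℚ) ≠ 0 := fun h =>
    Polynomial.scaleRoots_ne_zero hg D
      (Polynomial.map_injective (algebraMap ℤ ℚ) (algebraMap ℤ ℚ).injective_int
        (by rw [h, Polynomial.map_zero]))
  calc (minpoly ℚ ((D : ℂ) * γ)).natDegree ≤ ((g.scaleRoots D).map (algebraMap ℤ ℚ)).natDegree :=
        Polynomial.natDegree_le_natDegree (minpoly.degree_le_of_ne_zero ℚ _ h2 h1)
    _ = g.natDegree := by
        rw [Polynomial.natDegree_map_eq_of_injective (algebraMap ℤ ℚ).injective_int,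
          Polynomial.natDegree_scaleRoots]

/-- Coefficients of a composition with `C a * X`: `(p(aT))_i = a^i p_i`. -/
private theorem coeff_comp_C_mul_X (p : ℤ[X]) (a : ℤ) (i : ℕ) :
    (p.comp (Polynomial.C a * Polynomial.X)).coeff i = a ^ i * p.coeff i := by
  rw [Polynomial.comp_eq_sum_left, Polynomial.sum_def, Polynomial.finsetSum_coeff]
  simp_rw [mul_pow, ← Polynomial.C_pow, ← mul_assoc, ← Polynomial.C_mul, Polynomial.coeff_C_mul_X_pow]
  rw [Finset.sum_ite_eq]
  split_ifs with h
  · rw [mul_comm]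
  · rw [Polynomial.notMem_support_iff.mp h, mul_zero]

/-- Raw coefficient bound of the conjugate polynomial from a bound `B ≥ 1` on the conjugates of `Dγ`:
`|coeff_i| ≤ |D|^i · B^{d} · C(d, i)` (`d` its degree). -/
theorem abs_coeff_conjPoly_le {D : ℤ} (hD : D ≠ 0) {γ : ℂ} (hint : IsIntegral ℤ ((D : ℂ) * γ))
    {B : ℝ} (hB : 1 ≤ B)
    (hroots : ∀ w : ℂ, Polynomial.aeval w (minpoly ℤ ((D : ℂ) * γ)) = 0 → ‖w‖ ≤ B) (i : ℕ) :
    (|(conjPoly D γ).coeff i| : ℝ) ≤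
      (|(D : ℝ)|) ^ i * (B ^ (conjPoly D γ).natDegree * ((conjPoly D γ).natDegree.choose i : ℝ)) := by
  classical
  set q := minpoly ℤ ((D : ℂ) * γ) with hq
  have hmonic : q.Monic := minpoly.monic hint
  have hsplit : (q.map (Int.castRingHom ℂ)).Splits := IsAlgClosed.splits _
  have hroots' : ∀ w ∈ (q.map (Int.castRingHom ℂ)).roots, ‖w‖ ≤ B := fun w hw =>
    hroots w ((mem_roots_map_iff (minpoly.ne_zero hint) w).mp hw)
  have hc := Polynomial.coeff_le_of_roots_le (f := Int.castRingHom ℂ) i hmonic hsplit hroots'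
  rw [Polynomial.coeff_map, eq_intCast, Complex.norm_intCast] at hc
  have hcoeff : (conjPoly D γ).coeff i = D ^ i * q.coeff i := by
    rw [hq]; exact coeff_comp_C_mul_X _ _ _
  rw [natDegree_conjPoly hD, ← hq, hcoeff, Int.cast_mul, abs_mul, Int.cast_pow, abs_pow]
  refine mul_le_mul_of_nonneg_left (hc.trans ?_) (pow_nonneg (abs_nonneg _) _)
  exact mul_le_mul_of_nonneg_right (pow_le_pow_right₀ hB (Nat.sub_le _ _)) (Nat.cast_nonneg _)

/-- `n ≤ H_k^n`. -/
theorem natCast_le_hgt_pow (a b : ℕ → ℚ) (k n : ℕ) : (n : ℝ) ≤ hgt a b k ^ n := by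
  have h3 := three_le_hgt a b k
  calc (n : ℝ) ≤ (2 : ℝ) ^ n := by exact_mod_cast (@Nat.lt_two_pow_self n).le
    _ ≤ hgt a b k ^ n := pow_le_pow_left₀ (by norm_num) (by linarith) n

/-- `x^n = exp (n log x)` for `x > 0`. -/
private theorem pow_eq_exp_log {x : ℝ} (hx : 0 < x) (n : ℕ) : x ^ n = Real.exp (n * Real.log x) := by
  rw [Real.exp_nat_mul, Real.exp_log hx]

/-- POINTWISE conjugate data of `γ_k` with all raw bounds (degree, house, coefficients). -/
theorem conjData_pointwise {ℓ : ℝ} (a b : ℕ → ℚ) {P : ℤ[X]} (hP : P ≠ 0)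
    (h0 : ∀ z : ℂ, Polynomial.aeval z P = 0 → z ≠ 0) (hα : Polynomial.aeval (cexp ((ℓ : ℂ) * I)) P = 0)
    {A : ℝ} (hA1 : 1 ≤ A) (hA : ∀ z : ℂ, Polynomial.aeval z P = 0 → ‖z‖ ≤ A ∧ ‖z‖⁻¹ ≤ A) (k : ℕ)
    (m : ℕ) (hm : m = (2 * ((a k).den : ℤ) * (b k).num).natAbs)
    (D : ℤ) (hDdef : D = (P.leadingCoeff * P.trailingCoeff) ^ m) :
    conjPoly D (gam ℓ a b k) ≠ 0 ∧ Polynomial.aeval (gam ℓ a b k) (conjPoly D (gam ℓ a b k)) = 0 ∧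
      (∀ z : ℂ, Polynomial.aeval z (conjPoly D (gam ℓ a b k)) = 0 → IsConjRoot ℚ (gam ℓ a b k) z) ∧
      ((conjPoly D (gam ℓ a b k)).natDegree : ℝ) ≤ hgt a b k ^ (P.natDegree + 10) ∧
      (∀ z : ℂ, Polynomial.aeval z (conjPoly D (gam ℓ a b k)) = 0 → ‖z‖ ≤ A ^ m) ∧
      (∀ i, (|(conjPoly D (gam ℓ a b k)).coeff i| : ℝ) ≤
        ((|((P.leadingCoeff * P.trailingCoeff : ℤ) : ℝ)|) ^ m) ^ (2 * (conjPoly D (gam ℓ a b k)).natDegree) *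
          (A ^ m) ^ (conjPoly D (gam ℓ a b k)).natDegree * 2 ^ (conjPoly D (gam ℓ a b k)).natDegree) := by
  -- names
  obtain ⟨N, hNdef⟩ : ∃ N : ℕ, N = 2 * (a k).den * (b k).den := ⟨_, rfl⟩
  obtain ⟨M, hMdef⟩ : ∃ M : ℤ, M = 2 * ((a k).den : ℤ) * (b k).num := ⟨_, rfl⟩
  obtain ⟨γ, hγdef⟩ : ∃ γ : ℂ, γ = gam ℓ a b k := ⟨_, rfl⟩
  rw [← hMdef] at hm
  rw [← hγdef]
  have hN : 0 < N := by
    rw [hNdef]; exact Nat.mul_pos (Nat.mul_pos two_pos (a k).den_pos) (b k).den_pos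
  have hc0 : P.leadingCoeff * P.trailingCoeff ≠ 0 :=
    mul_ne_zero (Polynomial.leadingCoeff_ne_zero.mpr hP) (Polynomial.trailingCoeff_nonzero_iff_nonzero.mpr hP)
  have hD0 : D ≠ 0 := by rw [hDdef]; exact pow_ne_zero _ hc0
  have hD' : (D : ℂ) ≠ 0 := by exact_mod_cast hD0
  have hγenv : Polynomial.aeval γ (envPoly P N M) = 0 := by
    rw [hγdef, hNdef, hMdef]; exact aeval_envPoly_gam hP h0 hα k
  have hint : IsIntegral ℤ ((D : ℂ) * γ) := by
    rw [hDdef, hm]; exact isIntegral_denom_mul hP h0 hN M hγenv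
  have hconj : ∀ z : ℂ, Polynomial.aeval z (conjPoly D γ) = 0 → IsConjRoot ℚ γ z :=
    fun z hz => isConjRoot_of_aeval_conjPoly hD0 hint hz
  have hroots : ∀ z : ℂ, Polynomial.aeval z (conjPoly D γ) = 0 → ‖z‖ ≤ A ^ m := by
    intro z hz
    rw [hm]
    exact norm_le_of_aeval_envPoly hP h0 hA1 hA hN M (aeval_envPoly_conj (hconj z hz) hγenv)
  -- numerics of `H`
  have hH := three_le_hgt a b k
  have h1H : (1 : ℝ) ≤ hgt a b k := by linarith
  have h0H : (0 : ℝ) ≤ hgt a b k := by linarith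
  have hNle : (N : ℝ) ≤ 2 * hgt a b k ^ 2 := by rw [hNdef]; exact two_den_den_le a b k
  have hmle : (m : ℝ) ≤ 2 * hgt a b k ^ 2 := by
    rw [hm, Nat.cast_natAbs, Int.cast_abs, hMdef]; exact two_den_num_le a b k
  refine ⟨conjPoly_ne_zero hD0 hint, aeval_conjPoly_self D γ, hconj, ?_, hroots, ?_⟩
  · -- degree
    have h1 : (conjPoly D γ).natDegree ≤ (P.natDegree + (N + M.natAbs)) * (N + M.natAbs) :=
      (natDegree_conjPoly_le hD0 hint (envPoly_ne_zero hP h0 hN M) hγenv).trans (natDegree_envPoly_le P N M)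
    have h2 : ((conjPoly D γ).natDegree : ℝ) ≤ (P.natDegree + ((N : ℝ) + m)) * ((N : ℝ) + m) := by
      rw [hm]; exact_mod_cast h1
    refine h2.trans ?_
    have hdP : (P.natDegree : ℝ) ≤ hgt a b k ^ (P.natDegree + 4) :=
      (natCast_le_hgt_pow a b k P.natDegree).trans (pow_le_pow_right₀ h1H (by omega))
    have h4 : (N : ℝ) + m ≤ hgt a b k ^ 4 := by
      have hH2 : (4 : ℝ) ≤ hgt a b k ^ 2 := by nlinarith
      calc (N : ℝ) + m ≤ 4 * hgt a b k ^ 2 := by linarith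
        _ ≤ hgt a b k ^ 2 * hgt a b k ^ 2 := mul_le_mul_of_nonneg_right hH2 (pow_nonneg h0H _)
        _ = hgt a b k ^ 4 := by ring
    have h4' : (N : ℝ) + m ≤ hgt a b k ^ (P.natDegree + 4) :=
      h4.trans (pow_le_pow_right₀ h1H (by omega))
    have hsum : (P.natDegree : ℝ) + ((N : ℝ) + m) ≤ hgt a b k ^ (P.natDegree + 5) := by
      calc (P.natDegree : ℝ) + ((N : ℝ) + m) ≤ hgt a b k ^ (P.natDegree + 4) + hgt a b k ^ (P.natDegree + 4) :=
            add_le_add hdP h4'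
        _ = 2 * hgt a b k ^ (P.natDegree + 4) := by ring
        _ ≤ hgt a b k * hgt a b k ^ (P.natDegree + 4) :=
            mul_le_mul_of_nonneg_right (by linarith) (pow_nonneg h0H _)
        _ = hgt a b k ^ (P.natDegree + 5) := by ring
    have hNm0 : (0 : ℝ) ≤ (N : ℝ) + m := by positivity
    calc ((P.natDegree : ℝ) + ((N : ℝ) + m)) * ((N : ℝ) + m) ≤ hgt a b k ^ (P.natDegree + 5) * hgt a b k ^ 4 :=
          mul_le_mul hsum h4 hNm0 (pow_nonneg h0H _)
      _ = hgt a b k ^ (P.natDegree + 9) := by ring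
      _ ≤ hgt a b k ^ (P.natDegree + 10) := pow_le_pow_right₀ h1H (by omega)
  · -- coefficients
    intro i
    obtain ⟨d, hd⟩ : ∃ d : ℕ, d = (conjPoly D γ).natDegree := ⟨_, rfl⟩
    rw [← hd]
    have h1D : (1 : ℝ) ≤ |(D : ℝ)| := by exact_mod_cast Int.one_le_abs hD0
    have hAm : (1 : ℝ) ≤ A ^ m := one_le_pow₀ hA1
    obtain ⟨B, hBdef⟩ : ∃ B : ℝ, B = |(D : ℝ)| * A ^ m := ⟨_, rfl⟩
    have hB : 1 ≤ B := by rw [hBdef]; nlinarith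
    have hrootsβ : ∀ w : ℂ, Polynomial.aeval w (minpoly ℤ ((D : ℂ) * γ)) = 0 → ‖w‖ ≤ B := by
      intro w hw
      have hwD : (D : ℂ) * (w / D) = w := by field_simp
      have hz : Polynomial.aeval (w / D) (conjPoly D γ) = 0 := by
        rw [aeval_conjPoly, hwD]; exact hw
      have h := hroots _ hz
      rw [hBdef, ← hwD, norm_mul, Complex.norm_intCast]
      exact mul_le_mul_of_nonneg_left h (abs_nonneg _)
    have hDabs : |(D : ℝ)| = (|((P.leadingCoeff * P.trailingCoeff : ℤ) : ℝ)|) ^ m := by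
      rw [hDdef, Int.cast_pow, abs_pow]
    rw [← hDabs]
    by_cases hi : i ≤ d
    · have h := abs_coeff_conjPoly_le hD0 hint hB hrootsβ i
      rw [← hd] at h
      refine h.trans ?_
      have e1 : |(D : ℝ)| ^ i ≤ |(D : ℝ)| ^ d := pow_le_pow_right₀ h1D hi
      have e2 : (d.choose i : ℝ) ≤ 2 ^ d := by exact_mod_cast Nat.choose_le_two_pow d i
      have e3 : B ^ d = |(D : ℝ)| ^ d * (A ^ m) ^ d := by rw [hBdef, mul_pow]
      rw [e3]
      have hDd : (0 : ℝ) ≤ |(D : ℝ)| ^ d := pow_nonneg (abs_nonneg _) _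
      have hAd : (0 : ℝ) ≤ (A ^ m) ^ d := pow_nonneg (by positivity) _
      calc |(D : ℝ)| ^ i * (|(D : ℝ)| ^ d * (A ^ m) ^ d * (d.choose i : ℝ))
          ≤ |(D : ℝ)| ^ d * (|(D : ℝ)| ^ d * (A ^ m) ^ d * 2 ^ d) := by
            refine mul_le_mul e1 (mul_le_mul_of_nonneg_left e2 (mul_nonneg hDd hAd)) ?_ hDd
            exact mul_nonneg (mul_nonneg hDd hAd) (Nat.cast_nonneg _)
        _ = |(D : ℝ)| ^ (2 * d) * (A ^ m) ^ d * 2 ^ d := by ring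
    · push Not at hi
      rw [Polynomial.coeff_eq_zero_of_natDegree_lt (by rw [← hd]; exact hi), Int.cast_zero, abs_zero]
      positivity

/-- **`ConjDataII` holds**: the conjugate data of `γ_k = e^{iπ a_k} α^{b_k}` for algebraic `α = e^{iℓ}`. -/
theorem conjDataII_holds : ConjDataII := by
  intro ℓ a b halg
  have hα0 : cexp ((ℓ : ℂ) * I) ≠ 0 := Complex.exp_ne_zero _
  obtain ⟨P, hP, hPα, h0⟩ := exists_intPoly halg hα0
  obtain ⟨A, hA1, hA⟩ := exists_house_const hP
  have hApos : 0 < A := by linarith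
  obtain ⟨c, hcdef⟩ : ∃ c : ℤ, c = P.leadingCoeff * P.trailingCoeff := ⟨_, rfl⟩
  have hc0 : c ≠ 0 := by
    rw [hcdef]
    exact mul_ne_zero (Polynomial.leadingCoeff_ne_zero.mpr hP)
      (Polynomial.trailingCoeff_nonzero_iff_nonzero.mpr hP)
  have h1c : (1 : ℝ) ≤ |(c : ℝ)| := by exact_mod_cast Int.one_le_abs hc0
  have hlc : 0 ≤ Real.log |(c : ℝ)| := Real.log_nonneg h1c
  have hlA : 0 ≤ Real.log A := Real.log_nonneg hA1
  obtain ⟨L, hLdef⟩ : ∃ L : ℝ, L = 2 * Real.log A + 4 * Real.log |(c : ℝ)| + 1 := ⟨_, rfl⟩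
  have hL1 : 1 ≤ L := by rw [hLdef]; linarith
  obtain ⟨K, hK⟩ : ∃ K : ℕ, L ≤ K := ⟨⌈L⌉₊, Nat.le_ceil L⟩
  obtain ⟨m, hmdef⟩ : ∃ m : ℕ → ℕ, m = fun k => (2 * ((a k).den : ℤ) * (b k).num).natAbs := ⟨_, rfl⟩
  have hpt := fun k => conjData_pointwise a b hP h0 hPα hA1 hA k (m k) (by rw [hmdef]) (c ^ m k)
    (by rw [hcdef])
  refine ⟨fun k => conjPoly (c ^ m k) (gam ℓ a b k), P.natDegree + 12 + K, fun k => (hpt k).1,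
    fun k => (hpt k).2.1, fun k z hz => (hpt k).2.2.1 z hz, ?_, ?_, ?_⟩
  · -- degree
    refine Filter.Eventually.of_forall fun k => ?_
    have h1H : (1 : ℝ) ≤ hgt a b k := by linarith [three_le_hgt a b k]
    exact (hpt k).2.2.2.1.trans (pow_le_pow_right₀ h1H (by omega))
  · -- coefficients
    refine Filter.Eventually.of_forall fun k i => ?_
    have hH := three_le_hgt a b k
    have h1H : (1 : ℝ) ≤ hgt a b k := by linarith
    have h0H : (0 : ℝ) ≤ hgt a b k := by linarith
    have hmle : (m k : ℝ) ≤ 2 * hgt a b k ^ 2 := by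
      rw [hmdef]; dsimp only
      rw [Nat.cast_natAbs, Int.cast_abs]; exact two_den_num_le a b k
    have hdle : ((conjPoly (c ^ m k) (gam ℓ a b k)).natDegree : ℝ) ≤ hgt a b k ^ (P.natDegree + 10) :=
      (hpt k).2.2.2.1
    obtain ⟨d, hd⟩ : ∃ d : ℕ, d = (conjPoly (c ^ m k) (gam ℓ a b k)).natDegree := ⟨_, rfl⟩
    rw [← hd] at hdle
    have h := (hpt k).2.2.2.2.2 i
    rw [← hcdef, ← hd] at h
    refine h.trans ?_
    -- each factor as an exponential
    have hcpos : 0 < |(c : ℝ)| := by linarith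
    rw [← pow_mul, pow_eq_exp_log hcpos, ← pow_mul, pow_eq_exp_log hApos,
      pow_eq_exp_log (by norm_num : (0 : ℝ) < 2), ← Real.exp_add, ← Real.exp_add, Real.exp_le_exp]
    have hlog2 : Real.log 2 ≤ 1 := by
      have := Real.log_le_sub_one_of_pos (by norm_num : (0 : ℝ) < 2); linarith
    have hd0 : (0 : ℝ) ≤ d := Nat.cast_nonneg _
    have hm0 : (0 : ℝ) ≤ m k := Nat.cast_nonneg _
    push_cast
    -- (m·(2d)) log|c| + (m·d) log A + d log 2 ≤ d · H² · L ≤ H^(dP+10) · H² · H^K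
    have hKle : (K : ℝ) ≤ hgt a b k ^ K := natCast_le_hgt_pow a b k K
    have hLle : L ≤ hgt a b k ^ K := hK.trans hKle
    have step1 : ((m k : ℝ) * (2 * (d : ℝ))) * Real.log |(c : ℝ)| + ((m k : ℝ) * d) * Real.log A +
        (d : ℝ) * Real.log 2 ≤ (d : ℝ) * hgt a b k ^ 2 * L := by
      rw [hLdef]
      have t1 : ((m k : ℝ) * (2 * (d : ℝ))) * Real.log |(c : ℝ)| ≤ (d * hgt a b k ^ 2) * (4 * Real.log |(c : ℝ)|) := by
        have : ((m k : ℝ) * (2 * (d : ℝ))) ≤ 4 * (d * hgt a b k ^ 2) := by nlinarith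
        nlinarith
      have t2 : ((m k : ℝ) * d) * Real.log A ≤ (d * hgt a b k ^ 2) * (2 * Real.log A) := by
        have : ((m k : ℝ) * d) ≤ 2 * (d * hgt a b k ^ 2) := by nlinarith
        nlinarith
      have t3 : (d : ℝ) * Real.log 2 ≤ (d * hgt a b k ^ 2) * 1 := by
        have : (d : ℝ) ≤ d * hgt a b k ^ 2 := le_mul_of_one_le_right hd0 (one_le_pow₀ h1H)
        nlinarith
      nlinarith
    refine step1.trans ?_
    calc (d : ℝ) * hgt a b k ^ 2 * L ≤ hgt a b k ^ (P.natDegree + 10) * hgt a b k ^ 2 * hgt a b k ^ K := by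
          refine mul_le_mul (mul_le_mul_of_nonneg_right hdle (pow_nonneg h0H _)) hLle (by linarith) ?_
          exact mul_nonneg (pow_nonneg h0H _) (pow_nonneg h0H _)
      _ = hgt a b k ^ (P.natDegree + 12 + K) := by ring
  · -- roots
    refine Filter.Eventually.of_forall fun k z hz => ?_
    have hH := three_le_hgt a b k
    have h1H : (1 : ℝ) ≤ hgt a b k := by linarith
    have h0H : (0 : ℝ) ≤ hgt a b k := by linarith
    have hmle : (m k : ℝ) ≤ 2 * hgt a b k ^ 2 := by
      rw [hmdef]; dsimp only
      rw [Nat.cast_natAbs, Int.cast_abs]; exact two_den_num_le a b k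
    have h := (hpt k).2.2.2.2.1 z hz
    refine h.trans ?_
    rw [pow_eq_exp_log hApos, Real.exp_le_exp]
    have hKle : (K : ℝ) ≤ hgt a b k ^ K := natCast_le_hgt_pow a b k K
    have hLA : 2 * Real.log A ≤ L := by rw [hLdef]; linarith
    calc (m k : ℝ) * Real.log A ≤ 2 * hgt a b k ^ 2 * Real.log A := mul_le_mul_of_nonneg_right hmle hlA
      _ = hgt a b k ^ 2 * (2 * Real.log A) := by ring
      _ ≤ hgt a b k ^ 2 * hgt a b k ^ K :=
          mul_le_mul_of_nonneg_left (hLA.trans (hK.trans hKle)) (pow_nonneg h0H _)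
      _ = hgt a b k ^ (2 + K) := by ring
      _ ≤ hgt a b k ^ (P.natDegree + 12 + K) := pow_le_pow_right₀ h1H (by omega)

/-- **`InnerNormII` holds** and hence **`TransferII` holds** unconditionally. -/
theorem innerNormII_holds : InnerNormII := innerNormII_of_pieces conjDataII_holds nonVanishII_holds

/-- **TRANSFER II AS TYPED (since edition 1) IS A THEOREM**: `transferII_of_conjDataII conjDataII_holds` — hypothesis-free, axioms standard. -/
theorem transferII_holds : TransferII := transferII_of_conjDataII conjDataII_holds

/-- **The cell's verdict at the member from `TransferI` alone**: `SB 3 z_B` (the live item's conclusion at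
`z_B = (iπ, iℓ₀, i y_B)`) follows from the Case-I transfer principle — Case II is now a theorem. -/
theorem sb_three_zB_of_transferI (hI : TransferI) : SB 3 zB := sb_three_zB_of hI transferII_holds

end ConjDataDev

end Bilog
end LatCell
end HyperCell
end Summit.Schanuel.Schanuel.Theorems.RootDecomp1KHyper
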